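import Summits.HubbardSuperconductivity.HubbardLadder.PairSourceEnergyTLRowsTTPrime
import Summits.HubbardSuperconductivity.HubbardLadder.Bounds.LUCUpperBoundsTI3
import HarnessLib

/-!
# Route #2 at `(U, n, t') = (8, 7/8, −1/4)`: the TL upper row of record BY NAME and ONE sourced lower row
# give a certified CEILING on `d`-wave pair-field order along every admissible ground-state sequence

HONEST FRAMING: this file certifies NO number and makes no claim on `H`/`H₀` or on the CUPRATE QUESTION; it is a
PROVED implication whose inputs are (a) the typed thermodynamic-limit upper row
`Bounds.tlUpperTI_U8_tpm1o4_n7o8_16k_ti4ds` (`e(1,−1/4,8,7/8) ≤ −355026702567/2³⁹`, pub-hubbard V-TI11 torus family =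
mbsolver CERTIFIED #93 upper; a `@[conjecture]` claim node used as a HYPOTHESIS) and (b) a HYPOTHESIS-shaped sourced
lower row `∃ L₀, ∀ L ≥ L₀, e⁻·L² ≤ E₀(dWaveSourceTorusTT' L (−1/4) 8 μ h)` — the conclusion shape of a gauge-broken
window certificate for the pair-sourced `t–t'` torus (pilot `hubbard-cq-pilot-2`; NO instance is known or claimed).
Cell hubbard-cq (LADDER rung CQ, ABSENT/BOUNDED branch at `t' = −1/4`), seat hubbard-cq-obsth-3; the `t' = −1/4` twin
of `PairSourceEnergyRowsBridge.PairSourceEnergyRowsEdgeU8Eighth` (`t' = 0`), via the TL-rows form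
`liminf_dWaveOrderParamSq_le_of_tlRows_TT'` (this seat) — no sublattice or exact-density bookkeeping is needed.

Statement (`liminf_dWaveOrderParamSq_tpm1o4_U8_n7o8_le_of_tlUpperTI_of_sourcedLower`): (a) ∧ (b) ∧ `s := −355026702567/2³⁹ − (7/8)μ − e⁻ > 0` ⇒
along every sequence of unit ground states of `hubbardTorusTT' L 1 (−1/4) 8` in the sectors
`(rectN (7/8) L, S^z = 0)` (even sides), `liminf_k σ_d²(2k) ≤ s²/(2h²)`. Informativeness (labels, not claims): new
only if `s²/(2h²) < 128/π⁴` (`limsup_dWaveOrderParamSq_le_kinematic`, `t'`-independent); a tighter typed upper row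
(open-box MPS class) plugs into `liminf_dWaveOrderParamSq_le_of_tlRows_TT'` verbatim.

References: T. Koma, H. Tasaki, J. Stat. Phys. 76 (1994) 745, Theorem 2.2; H. Xu et al., Science 384 (2024)
eadh7691, eq. (1); M. Qin et al., Phys. Rev. X 10 (2020) 031016, §IV.
-/

noncomputable section

namespace Summit.HubbardSuperconductivity.HubbardLadder

open Matrix Filter Literature.Probability.LatticeModels
open Literature.MathematicalPhysics.QuantumLattice ThermodynamicLimit
open Summit.HubbardSuperconductivity.HubbardLadder.Bounds (tlUpperTI_U8_tpm1o4_n7o8_16k_ti4ds)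
open scoped ComplexOrder Topology

/-- **EDGE of route #2 at `t' = −1/4` (an implication, not a claim about either row)**: the TL upper row
`tlUpperTI_U8_tpm1o4_n7o8_16k_ti4ds` AND a grand-canonical pair-sourced lower bound
`eL·L² ≤ E₀(dWaveSourceTorusTT' L (−1/4) 8 μ h)` for all large `L` (HYPOTHESIS; no instance known) with positive
slack `s = −355026702567/2³⁹ − (7/8)μ − eL` imply, along every admissible sequence of normalised `S^z = 0` sector
ground states of the `t' = −1/4` tori at `U = 8`, `n = 7/8` (`N_L = rectN (7/8) L`), `liminf_k σ_d²(2k) ≤ s²/(2h²)`.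
HONEST FRAMING: no number certified; no claim on `H`/`H₀`. [cite: KomaTasaki1994, Theorem 2.2] -/
theorem liminf_dWaveOrderParamSq_tpm1o4_U8_n7o8_le_of_tlUpperTI_of_sourcedLower
    (hrow : tlUpperTI_U8_tpm1o4_n7o8_16k_ti4ds) (μ : ℝ) {h eL : ℝ} (hh : 0 < h)
    (hs : 0 < (-355026702567 : ℝ) / 2 ^ 39 - μ * (7 / 8) - eL)
    (hb : ∃ L₀ : ℕ, ∀ (L : ℕ) [NeZero L], L₀ ≤ L →
      eL * (L : ℝ) ^ 2 ≤ (dWaveSourceTorusTT' L ((-1 : ℝ) / 4) 8 μ h).groundEnergy)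
    (ψ : ∀ L, Fock (Orb (FermionTorus 2 L)))
    (hψ : ∀ L, Even L → star (ψ L) ⬝ᵥ ψ L = 1 ∧
      IsGroundStateInSector (hubbardTorusTT' L 1 ((-1 : ℝ) / 4) 8) (rectN (7 / 8) L) 0 (ψ L)) :
    liminf (fun k => dWaveOrderParamSq ψ k) atTop ≤
      ((-355026702567 : ℝ) / 2 ^ 39 - μ * (7 / 8) - eL) ^ 2 / (2 * h ^ 2) :=
  liminf_dWaveOrderParamSq_le_of_tlRows_TT' ((-1 : ℝ) / 4) (U := 8) (by norm_num) (n := 7 / 8)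
    (by norm_num) (by norm_num) μ hh hrow hb hs ψ hψ

end Summit.HubbardSuperconductivity.HubbardLadder

end
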